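import Summits.QuantumFields.QCD.Theorems.PauliWegnerSeaChiralGluonicCompletionGlobalContinuum

/-!
# Crux `ChiralGluonicCompletion` (stmt-QuantumFields-17498), line `Sketch` — the planner-facing certificates of the line
# (lead cycle 4, 2026-08-17): what the crux closes modulo, for each typing of its chiral input

Skeleton rev 5 (`Cruxes/ChiralGluonicCompletion/Lines/Sketch.lean`) reduces the crux to three registered stubs — E*
(`stub_hereditaryPin`: along SOME subsequence the pin `IsChiralAtZero` holds along EVERY further one), C1 (`stub_latticeGap`:
the signed lattice gap at every positive tuple of the GIVEN regularisation) and C2' (`stub_continuum`: one gap-conditioned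
subsequence carrying the continuum half at every positive tuple) — and the composition is landed
(`chiralGluonicCompletion_of_hereditaryPin_globalContinuum`).  Cycle 3 certified that the residual content of E* over the
crux's hypothesis `Hyp` is exactly the `∃ᶠ k ↦ ∀ᶠ k` upgrade of the typed pin along one infinite set of cutoffs
(`hereditaryPin_iff_eventualPin_along_subsequences`), which `Hyp` does not supply.  This file lands, sorry-free and with
C1 / C2' as explicit hypotheses (never as stubs), the statements the planners need in order to act on that finding:

* `eventualPin_of_hasGoldstoneBound` — the eventual Goldstone lower bound of `QCDGoldstoneBound.lean` (the clause `G` that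
  `DiagonalSpine.ChiralTuning` delivers, `hasGoldstoneBound_iff`) already gives the EVENTUAL pin; `eventualPin_restrict` —
  the eventual pin is hereditary along every reindexing; `hypEventual_restrict` — so the crux's hypothesis with the
  eventual pin in place of `IsChiralAtZero` is subsequence-stable with NO further input (the typed `Hyp` is not:
  `hyp_restrict` needs a Goldstone bound to regain the pin).
* `qcdOf_of_hereditaryPin_of_stubs` — per-witness assembly: a `Hyp`-witness with the hereditary pin along some
  subsequence completes to `QCDOf N_f` modulo C1 and C2' (the body of the landed composition, for ONE regularisation).
* `chiralGluonicCompletionEventual_of_stubs` / `chiralGluonicCompletionGoldstone_of_stubs` — the crux RE-TYPED with the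
  eventual pin, resp. with `reg.HasGoldstoneBound`, in place of `reg.IsChiralAtZero` in its hypothesis closes modulo
  C1 and C2' ONLY (no chirality stub); and `chiralGluonicCompletionEventual_of_crux` / `…Goldstone_of_crux` — both
  re-typings are implied by the crux as typed (they have stronger hypotheses), so nothing banked on the crux is lost.
All statements are spelled out inline in the tree's vocabulary (no new definitions).
-/

noncomputable section

namespace Summit.QuantumFields.QCD.Theorems.StronglyChiralSubsequence

open MeasureTheory Filter Topology
open Literature.MathematicalPhysics.QuantumFieldTheory Literature.MathematicalPhysics.QuantumLattice
  Literature.Probability.LatticeModels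

variable {Nf : ℕ}

/-! ## §1 The eventual pin: from the Goldstone bound, and hereditary -/

/-- **The Goldstone bound gives the EVENTUAL pin.**  If `reg` has the eventual Goldstone lower bound at every rate
(`QCDRegularisation.HasGoldstoneBound`), then for every rate `ε > 0` some positive tuple and ONE channel violate the
`ε`-gap bound at EVERY level `C` for ALL LARGE `k`: take the Goldstone witnesses at rate `ε` (rate `μ < ε`, constant
`c > 0`, tori `S_k ≥ L_k`, separations `n_k ≤ S_k`, `a_k n_k → ∞`); since `c e^{(ε-μ) a_k n_k} → ∞`, eventually
`C e^{-ε a_k n_k} < c e^{-μ a_k n_k} ≤ ‖corr‖`. -/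
theorem eventualPin_of_hasGoldstoneBound (reg : QCDRegularisation Nf) (hG : reg.HasGoldstoneBound) :
    ∀ ε > (0 : ℝ), ∃ m : Fin Nf → ℝ, (∀ f, 0 < m f) ∧
      ∃ (R R' : ℕ) (A : QCDLatticeObservable Nf R) (B : QCDLatticeObservable Nf R'), ∀ C : ℝ, ∀ᶠ k in atTop,
        ∃ S : ℕ, reg.L k ≤ S ∧ ∃ n : ℕ, n ≤ S ∧ C * Real.exp (-(ε * (reg.a k * n))) <
          ‖qcdLatticeConnectedCorr (reg.β k) (2 * S + 1) (fun fl => (reg.scheme m 0 0).mq fl k) A B n‖ := by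
  intro ε hε
  obtain ⟨m, hm, μ, c, hμ, hc, R, R', A, B, S, n, hLS, hnS, hdiv, hev⟩ := hG ε hε
  refine ⟨m, hm, R, R', A, B, fun C => ?_⟩
  -- `c e^{(ε-μ) a_k n_k} → ∞`, so it eventually exceeds `C`
  have hexp : Tendsto (fun k => c * Real.exp ((ε - μ) * (reg.a k * n k))) atTop atTop :=
    (Real.tendsto_exp_atTop.comp (hdiv.const_mul_atTop (sub_pos.2 hμ))).const_mul_atTop hc
  filter_upwards [hev, hexp.eventually_gt_atTop C] with k hk hkC
  refine ⟨S k, hLS k, n k, hnS k, lt_of_lt_of_le ?_ hk⟩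
  -- `C e^{-ε x} < c e^{-μ x}` from `C < c e^{(ε-μ) x}`
  have hpos : 0 < Real.exp (-(ε * (reg.a k * n k))) := Real.exp_pos _
  calc C * Real.exp (-(ε * (reg.a k * n k)))
      < c * Real.exp ((ε - μ) * (reg.a k * n k)) * Real.exp (-(ε * (reg.a k * n k))) :=
        mul_lt_mul_of_pos_right hkC hpos
    _ = c * Real.exp (-(μ * (reg.a k * n k))) := by
        rw [mul_assoc, ← Real.exp_add]
        congr 1
        ring_nf

/-- **The eventual pin is hereditary**: it passes to `reg.restrict φ` for every `φ → ∞` (same tuple and channel; the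
`∀ᶠ k` clause composes with `φ`, and the `k`-th data of the restriction are the `φ k`-th data of `reg`). -/
theorem eventualPin_restrict (reg : QCDRegularisation Nf)
    (h : ∀ ε > (0 : ℝ), ∃ m : Fin Nf → ℝ, (∀ f, 0 < m f) ∧
      ∃ (R R' : ℕ) (A : QCDLatticeObservable Nf R) (B : QCDLatticeObservable Nf R'), ∀ C : ℝ, ∀ᶠ k in atTop,
        ∃ S : ℕ, reg.L k ≤ S ∧ ∃ n : ℕ, n ≤ S ∧ C * Real.exp (-(ε * (reg.a k * n))) <
          ‖qcdLatticeConnectedCorr (reg.β k) (2 * S + 1) (fun fl => (reg.scheme m 0 0).mq fl k) A B n‖)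
    (φ : ℕ → ℕ) (hφ : Tendsto φ atTop atTop) :
    ∀ ε > (0 : ℝ), ∃ m : Fin Nf → ℝ, (∀ f, 0 < m f) ∧
      ∃ (R R' : ℕ) (A : QCDLatticeObservable Nf R) (B : QCDLatticeObservable Nf R'), ∀ C : ℝ, ∀ᶠ k in atTop,
        ∃ S : ℕ, (reg.restrict φ hφ).L k ≤ S ∧ ∃ n : ℕ, n ≤ S ∧
          C * Real.exp (-(ε * ((reg.restrict φ hφ).a k * n))) <
            ‖qcdLatticeConnectedCorr ((reg.restrict φ hφ).β k) (2 * S + 1)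
              (fun fl => ((reg.restrict φ hφ).scheme m 0 0).mq fl k) A B n‖ := by
  intro ε hε
  obtain ⟨m, hm, R, R', A, B, hAB⟩ := h ε hε
  exact ⟨m, hm, R, R', A, B, fun C => hφ.eventually (hAB C)⟩

/-- **The re-typed hypothesis is subsequence-stable with no further input.**  If `reg` carries mass scaling, the
EVENTUAL pin, asymptotic scaling and the per-mass package, so does `reg.restrict φ` for every strictly increasing `φ`
(all four are tail properties; contrast `hyp_restrict`, where the typed `∃ᶠ` pin has to be regained from a Goldstone
bound of the subsequence). -/
theorem hypEventual_restrict (reg : QCDRegularisation Nf) (φ : ℕ → ℕ) (hφ : StrictMono φ)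
    (h : reg.HasMassScaling ∧
      (∀ ε > (0 : ℝ), ∃ m : Fin Nf → ℝ, (∀ f, 0 < m f) ∧
        ∃ (R R' : ℕ) (A : QCDLatticeObservable Nf R) (B : QCDLatticeObservable Nf R'), ∀ C : ℝ, ∀ᶠ k in atTop,
          ∃ S : ℕ, reg.L k ≤ S ∧ ∃ n : ℕ, n ≤ S ∧ C * Real.exp (-(ε * (reg.a k * n))) <
            ‖qcdLatticeConnectedCorr (reg.β k) (2 * S + 1) (fun fl => (reg.scheme m 0 0).mq fl k) A B n‖) ∧
      (reg.scheme 0 0 0).HasAsymptoticScaling ∧ ∀ m : Fin Nf → ℝ, (∀ f, 0 < m f) → PerMass Nf reg m) :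
    (reg.restrict φ hφ.tendsto_atTop).HasMassScaling ∧
      (∀ ε > (0 : ℝ), ∃ m : Fin Nf → ℝ, (∀ f, 0 < m f) ∧
        ∃ (R R' : ℕ) (A : QCDLatticeObservable Nf R) (B : QCDLatticeObservable Nf R'), ∀ C : ℝ, ∀ᶠ k in atTop,
          ∃ S : ℕ, (reg.restrict φ hφ.tendsto_atTop).L k ≤ S ∧ ∃ n : ℕ, n ≤ S ∧
            C * Real.exp (-(ε * ((reg.restrict φ hφ.tendsto_atTop).a k * n))) <
              ‖qcdLatticeConnectedCorr ((reg.restrict φ hφ.tendsto_atTop).β k) (2 * S + 1)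
                (fun fl => ((reg.restrict φ hφ.tendsto_atTop).scheme m 0 0).mq fl k) A B n‖) ∧
      ((reg.restrict φ hφ.tendsto_atTop).scheme 0 0 0).HasAsymptoticScaling ∧
        ∀ m : Fin Nf → ℝ, (∀ f, 0 < m f) → PerMass Nf (reg.restrict φ hφ.tendsto_atTop) m :=
  ⟨hasMassScaling_restrict reg φ hφ h.1, eventualPin_restrict reg h.2.1 φ hφ.tendsto_atTop,
    hasAsymptoticScaling_restrict reg φ hφ h.2.2.1, fun m hm => perMass_restrict reg φ hφ m (h.2.2.2 m hm)⟩

/-! ## §2 Per-witness assembly modulo C1 and C2' -/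

/-- **Per-witness assembly of the line, modulo C1 and C2'.**  Given the two analytic stubs as hypotheses — (C1) the signed
lattice gap at every positive tuple of every `Hyp`-witness, (C2') one gap-conditioned subsequence carrying the continuum
half at every positive tuple — a `Hyp`-witness `reg` whose pin holds HEREDITARILY along some subsequence `reg.restrict φ`
completes to `QCDOf N_f`: E* ∧ C1 give a Goldstone subsequence `reg.restrict θ`
(`exists_restrict_hasGoldstoneBound_of_hereditaryPin`), which inherits the package (`hyp_restrict`); C2' along it —
fed with C1's gap there — gives `φ₁`; the Goldstone bound, hence the package and the pin, pass to
`(reg.restrict θ).restrict φ₁`, where C1 supplies the lattice gap and `body_of_parts` the matrix of `QCDOf`. -/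
theorem qcdOf_of_hereditaryPin_of_stubs
    (hC1 : ∀ Nf : ℕ, Nf = 2 ∨ Nf = 3 → ∀ reg : QCDRegularisation Nf, Hyp Nf reg →
      ∀ m : Fin Nf → ℝ, (∀ f, 0 < m f) → ∃ Δ > 0, (reg.scheme m 0 0).HasLatticeMassGap Δ)
    (hC2 : ∀ Nf : ℕ, Nf = 2 ∨ Nf = 3 → ∀ reg : QCDRegularisation Nf, Hyp Nf reg →
      (∀ m : Fin Nf → ℝ, (∀ f, 0 < m f) → ∃ Δ > 0, (reg.scheme m 0 0).HasLatticeMassGap Δ) →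
        ∃ φ : ℕ → ℕ, ∃ hφ : StrictMono φ, ∀ m : Fin Nf → ℝ, (∀ f, 0 < m f) →
          ContinuumBody Nf (reg.restrict φ hφ.tendsto_atTop) m)
    (hNf : Nf = 2 ∨ Nf = 3) (reg : QCDRegularisation Nf) (hH : Hyp Nf reg)
    (hE : ∃ φ : ℕ → ℕ, ∃ hφ : StrictMono φ, ∀ (ψ : ℕ → ℕ) (hψ : StrictMono ψ),
      ((reg.restrict φ hφ.tendsto_atTop).restrict ψ hψ.tendsto_atTop).IsChiralAtZero) :
    QCDOf Nf := by
  obtain ⟨φ, hφ, hher⟩ := hE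
  obtain ⟨θ, hθ, hG⟩ := exists_restrict_hasGoldstoneBound_of_hereditaryPin reg φ hφ hher (hC1 Nf hNf reg hH)
  have hH₀ : Hyp Nf (reg.restrict θ hθ.tendsto_atTop) := hyp_restrict reg θ hθ hH hG
  obtain ⟨φ₁, hφ₁, hcont⟩ := hC2 Nf hNf _ hH₀ (hC1 Nf hNf _ hH₀)
  have hG₁ : ((reg.restrict θ hθ.tendsto_atTop).restrict φ₁ hφ₁.tendsto_atTop).HasGoldstoneBound :=
    hG.restrict φ₁ hφ₁.tendsto_atTop
  have hH₁ : Hyp Nf ((reg.restrict θ hθ.tendsto_atTop).restrict φ₁ hφ₁.tendsto_atTop) :=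
    hyp_restrict _ φ₁ hφ₁ hH₀ hG₁
  unfold QCDOf
  exact ⟨(reg.restrict θ hθ.tendsto_atTop).restrict φ₁ hφ₁.tendsto_atTop, hH₁.1, hG₁.isChiralAtZero,
    fun m hm => body_of_parts _ m (hcont m hm) (hC1 Nf hNf _ hH₁ m hm)⟩

/-- **Under the EVENTUAL pin the chirality stub disappears** (per witness): a `Hyp`-witness whose pin holds in `∀ᶠ k`
form completes to `QCDOf N_f` modulo C1 and C2' only — the eventual pin is hereditary (`hereditaryPin_of_eventual`,
E* with `φ = id`). -/
theorem qcdOf_of_eventualPin_of_stubs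
    (hC1 : ∀ Nf : ℕ, Nf = 2 ∨ Nf = 3 → ∀ reg : QCDRegularisation Nf, Hyp Nf reg →
      ∀ m : Fin Nf → ℝ, (∀ f, 0 < m f) → ∃ Δ > 0, (reg.scheme m 0 0).HasLatticeMassGap Δ)
    (hC2 : ∀ Nf : ℕ, Nf = 2 ∨ Nf = 3 → ∀ reg : QCDRegularisation Nf, Hyp Nf reg →
      (∀ m : Fin Nf → ℝ, (∀ f, 0 < m f) → ∃ Δ > 0, (reg.scheme m 0 0).HasLatticeMassGap Δ) →
        ∃ φ : ℕ → ℕ, ∃ hφ : StrictMono φ, ∀ m : Fin Nf → ℝ, (∀ f, 0 < m f) →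
          ContinuumBody Nf (reg.restrict φ hφ.tendsto_atTop) m)
    (hNf : Nf = 2 ∨ Nf = 3) (reg : QCDRegularisation Nf) (hH : Hyp Nf reg)
    (hEv : ∀ ε > (0 : ℝ), ∃ m : Fin Nf → ℝ, (∀ f, 0 < m f) ∧
      ∃ (R R' : ℕ) (A : QCDLatticeObservable Nf R) (B : QCDLatticeObservable Nf R'), ∀ C : ℝ, ∀ᶠ k in atTop,
        ∃ S : ℕ, reg.L k ≤ S ∧ ∃ n : ℕ, n ≤ S ∧ C * Real.exp (-(ε * (reg.a k * n))) <
          ‖qcdLatticeConnectedCorr (reg.β k) (2 * S + 1) (fun fl => (reg.scheme m 0 0).mq fl k) A B n‖) :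
    QCDOf Nf :=
  qcdOf_of_hereditaryPin_of_stubs hC1 hC2 hNf reg hH
    ⟨id, strictMono_id, hereditaryPin_of_eventual reg hEv⟩

/-! ## §3 The two re-typings of the crux close modulo C1 and C2' only, and are implied by the crux as typed -/

/-- **The crux re-typed with the EVENTUAL pin closes modulo C1 ∧ C2'.**  Replace `reg.IsChiralAtZero` in the hypothesis
of `ChiralGluonicCompletion` by its `∀ᶠ k` form (for every rate, ONE positive tuple and ONE channel violating the gap bound
at every level for all large `k`); then, given C1 and C2', the implication to `QCDOf N_f` holds with no chirality stub:
the eventual pin implies the typed one (`hereditaryPin_of_eventual` at `ψ = id`, so the witness is a `Hyp`-witness) and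
`qcdOf_of_eventualPin_of_stubs` assembles. -/
theorem chiralGluonicCompletionEventual_of_stubs
    (hC1 : ∀ Nf : ℕ, Nf = 2 ∨ Nf = 3 → ∀ reg : QCDRegularisation Nf, Hyp Nf reg →
      ∀ m : Fin Nf → ℝ, (∀ f, 0 < m f) → ∃ Δ > 0, (reg.scheme m 0 0).HasLatticeMassGap Δ)
    (hC2 : ∀ Nf : ℕ, Nf = 2 ∨ Nf = 3 → ∀ reg : QCDRegularisation Nf, Hyp Nf reg →
      (∀ m : Fin Nf → ℝ, (∀ f, 0 < m f) → ∃ Δ > 0, (reg.scheme m 0 0).HasLatticeMassGap Δ) →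
        ∃ φ : ℕ → ℕ, ∃ hφ : StrictMono φ, ∀ m : Fin Nf → ℝ, (∀ f, 0 < m f) →
          ContinuumBody Nf (reg.restrict φ hφ.tendsto_atTop) m) :
    ∀ Nf : ℕ, Nf = 2 ∨ Nf = 3 →
      (∃ reg : QCDRegularisation Nf, reg.HasMassScaling ∧
        (∀ ε > (0 : ℝ), ∃ m : Fin Nf → ℝ, (∀ f, 0 < m f) ∧
          ∃ (R R' : ℕ) (A : QCDLatticeObservable Nf R) (B : QCDLatticeObservable Nf R'), ∀ C : ℝ, ∀ᶠ k in atTop,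
            ∃ S : ℕ, reg.L k ≤ S ∧ ∃ n : ℕ, n ≤ S ∧ C * Real.exp (-(ε * (reg.a k * n))) <
              ‖qcdLatticeConnectedCorr (reg.β k) (2 * S + 1) (fun fl => (reg.scheme m 0 0).mq fl k) A B n‖) ∧
        (reg.scheme 0 0 0).HasAsymptoticScaling ∧ ∀ m : Fin Nf → ℝ, (∀ f, 0 < m f) → PerMass Nf reg m) →
      QCDOf Nf := by
  rintro Nf hNf ⟨reg, hMS, hEv, hAS, hPM⟩
  exact qcdOf_of_eventualPin_of_stubs hC1 hC2 hNf reg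
    ⟨hMS, hereditaryPin_of_eventual reg hEv id strictMono_id, hAS, hPM⟩ hEv

/-- **The crux re-typed with the GOLDSTONE bound closes modulo C1 ∧ C2'.**  Replace `reg.IsChiralAtZero` by
`reg.HasGoldstoneBound` (the clause `G` of `DiagonalSpine.ChiralTuning`, `QCDRegularisation.hasGoldstoneBound_iff`); the
Goldstone bound gives the eventual pin (`eventualPin_of_hasGoldstoneBound`) and the previous theorem applies. -/
theorem chiralGluonicCompletionGoldstone_of_stubs
    (hC1 : ∀ Nf : ℕ, Nf = 2 ∨ Nf = 3 → ∀ reg : QCDRegularisation Nf, Hyp Nf reg →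
      ∀ m : Fin Nf → ℝ, (∀ f, 0 < m f) → ∃ Δ > 0, (reg.scheme m 0 0).HasLatticeMassGap Δ)
    (hC2 : ∀ Nf : ℕ, Nf = 2 ∨ Nf = 3 → ∀ reg : QCDRegularisation Nf, Hyp Nf reg →
      (∀ m : Fin Nf → ℝ, (∀ f, 0 < m f) → ∃ Δ > 0, (reg.scheme m 0 0).HasLatticeMassGap Δ) →
        ∃ φ : ℕ → ℕ, ∃ hφ : StrictMono φ, ∀ m : Fin Nf → ℝ, (∀ f, 0 < m f) →
          ContinuumBody Nf (reg.restrict φ hφ.tendsto_atTop) m) :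
    ∀ Nf : ℕ, Nf = 2 ∨ Nf = 3 →
      (∃ reg : QCDRegularisation Nf, reg.HasMassScaling ∧ reg.HasGoldstoneBound ∧
        (reg.scheme 0 0 0).HasAsymptoticScaling ∧ ∀ m : Fin Nf → ℝ, (∀ f, 0 < m f) → PerMass Nf reg m) →
      QCDOf Nf := by
  rintro Nf hNf ⟨reg, hMS, hG, hAS, hPM⟩
  exact chiralGluonicCompletionEventual_of_stubs hC1 hC2 Nf hNf
    ⟨reg, hMS, eventualPin_of_hasGoldstoneBound reg hG, hAS, hPM⟩

/-- **The eventual re-typing is implied by the crux as typed** (its hypothesis is stronger: the eventual pin implies the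
typed pin), so every lemma banked on `ChiralGluonicCompletion` transfers to it. -/
theorem chiralGluonicCompletionEventual_of_crux
    (h : Summit.QuantumFields.QCD.Theses.PauliWegnerSea.ChiralGluonicCompletion) :
    ∀ Nf : ℕ, Nf = 2 ∨ Nf = 3 →
      (∃ reg : QCDRegularisation Nf, reg.HasMassScaling ∧
        (∀ ε > (0 : ℝ), ∃ m : Fin Nf → ℝ, (∀ f, 0 < m f) ∧
          ∃ (R R' : ℕ) (A : QCDLatticeObservable Nf R) (B : QCDLatticeObservable Nf R'), ∀ C : ℝ, ∀ᶠ k in atTop,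
            ∃ S : ℕ, reg.L k ≤ S ∧ ∃ n : ℕ, n ≤ S ∧ C * Real.exp (-(ε * (reg.a k * n))) <
              ‖qcdLatticeConnectedCorr (reg.β k) (2 * S + 1) (fun fl => (reg.scheme m 0 0).mq fl k) A B n‖) ∧
        (reg.scheme 0 0 0).HasAsymptoticScaling ∧ ∀ m : Fin Nf → ℝ, (∀ f, 0 < m f) → PerMass Nf reg m) →
      QCDOf Nf := by
  rintro Nf hNf ⟨reg, hMS, hEv, hAS, hPM⟩
  exact h Nf hNf ⟨reg, hMS, hereditaryPin_of_eventual reg hEv id strictMono_id, hAS, hPM⟩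

/-- **The Goldstone re-typing is implied by the crux as typed** (`HasGoldstoneBound.isChiralAtZero`). -/
theorem chiralGluonicCompletionGoldstone_of_crux
    (h : Summit.QuantumFields.QCD.Theses.PauliWegnerSea.ChiralGluonicCompletion) :
    ∀ Nf : ℕ, Nf = 2 ∨ Nf = 3 →
      (∃ reg : QCDRegularisation Nf, reg.HasMassScaling ∧ reg.HasGoldstoneBound ∧
        (reg.scheme 0 0 0).HasAsymptoticScaling ∧ ∀ m : Fin Nf → ℝ, (∀ f, 0 < m f) → PerMass Nf reg m) →
      QCDOf Nf := by
  rintro Nf hNf ⟨reg, hMS, hG, hAS, hPM⟩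
  exact h Nf hNf ⟨reg, hMS, hG.isChiralAtZero, hAS, hPM⟩

/-! ## §4 Registered sub-goal of the line (one-line signature): the re-typed crux modulo C1 ∧ C2' -/

/-- **Registered sub-goal `chiralGluonicCompletionRetyped_of_stubs`** (the planner-facing content of this file in one
line): stub C1 → stub C2' → the crux with the EVENTUAL pin in place of `reg.IsChiralAtZero`.  By
`chiralGluonicCompletionEventual_of_stubs`. -/
theorem chiralGluonicCompletionRetyped_of_stubs : (∀ Nf : ℕ, Nf = 2 ∨ Nf = 3 → ∀ reg : QCDRegularisation Nf, Hyp Nf reg → ∀ m : Fin Nf → ℝ, (∀ f, 0 < m f) → ∃ Δ > 0, (reg.scheme m 0 0).HasLatticeMassGap Δ) → (∀ Nf : ℕ, Nf = 2 ∨ Nf = 3 → ∀ reg : QCDRegularisation Nf, Hyp Nf reg → (∀ m : Fin Nf → ℝ, (∀ f, 0 < m f) → ∃ Δ > 0, (reg.scheme m 0 0).HasLatticeMassGap Δ) → ∃ φ : ℕ → ℕ, ∃ hφ : StrictMono φ, ∀ m : Fin Nf → ℝ, (∀ f, 0 < m f) → ContinuumBody Nf (reg.restrict φ hφ.tendsto_atTop)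 m) → ∀ Nf : ℕ, Nf = 2 ∨ Nf = 3 → (∃ reg : QCDRegularisation Nf, reg.HasMassScaling ∧ (∀ ε > (0 : ℝ), ∃ m : Fin Nf → ℝ, (∀ f, 0 < m f) ∧ ∃ (R R' : ℕ) (A : QCDLatticeObservable Nf R) (B : QCDLatticeObservable Nf R'), ∀ C : ℝ, ∀ᶠ k in atTop, ∃ S : ℕ, reg.L k ≤ S ∧ ∃ n : ℕ, n ≤ S ∧ C * Real.exp (-(ε * (reg.a k * n))) < ‖qcdLatticeConnectedCorr (reg.β k) (2 * S + 1) (fun fl => (reg.scheme m 0 0).mq fl k) A B n‖) ∧ (reg.scheme 0 0 0).HasAsymptoticScaling ∧ ∀ m : Fin Nf → ℝ, (∀ f, 0 < m f) → PerMass Nf reg m) → QCDOf Nf :=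
  fun hC1 hC2 => chiralGluonicCompletionEventual_of_stubs hC1 hC2

end Summit.QuantumFields.QCD.Theorems.StronglyChiralSubsequence

end
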